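import Summits.QuantumFields.YangMills.Theorems.BalabanUVNodesK0TwoPrimeOfLipschitzCollar

/-!
# K0⁷ — RADIUS BLINDNESS OF THE β OF RECORD READS ONLY THE `K`-TAIL: the read-set induction (g19 `…K0Beta13RadiusBlind` §3 ∕ §5) with every row asked only at the pairs
# `(K, k)` of a LEVEL GUARD `G K k` that is antitone in `k` and holds EVENTUALLY in `K` at each level — the S1c witness's guard `k + c₀ ≤ m + K` qualifies — plus the
# SINGLE-LEVEL editions of the p. 266–267 rider and of the collar row (file 3 §2) that such a guard can feed

Cell `pub-ymgap`, width seat `pub-ymgap-dag-n07-w3` (g21; N07 [B11] ∕ K0⁷ junction).  `--kind proof --supports stmt-QuantumFields-20541 --as helper`, COUNT-NEUTRAL.  NEW leaf; theorems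
only — 0 `def`, 0 `sorry`, 0 `instance`, 0 `notation`.  Imports ONLY this seat's g20 file 3 `…K0TwoPrimeOfLipschitzCollar` (✓p792424; through it g19's `…K0Beta13RadiusBlind{,FirstForm}`,
dag-n09-w4's rider `…N09B0RiderAtRecord`, files 1–2).  Route-independent.  [I] = [Balaban1987RG1]; [15] = [Balaban1985Variational]; [III] = [Balaban1988Convergent]; [B7] = [Balaban1985Averaging].

WHY (g20's LOCATED «S1c LEVEL GUARD», `RADIUS-COLLAPSE-DOOR-BILL.g20.md` §LOCATED, second obstruction).  The doors of g19∕g20∕g21 display N07's slot `hT1` (Theorem 1 at objects) at EVERY member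
`(K, k)`, while the texts that produce it in the tree — the PROVED (8)-text (dag-n07-e ✓p767981, N = 2) and N12's EU-text, through this seat's (T1) socket `…K0TopSocketOfThm1EUText.thm1Objects_of_texts`
— carry the S1c witness's guard `k + c₀ ≤ F.m + K` (`c₀ ≥ m + 48`: the 48 coarsest levels of EVERY torus are excluded).  THIS FILE shows the guard is NO OBSTRUCTION FOR β: the β of record at step
`k` is `betaOfMerged (betaMerged …) …` with `betaMerged … k hist = secondMoment (polLimit F (k+1) (fun K => 𝓝_{k+1}(hist; ·) on torus K) …)` and `polLimit = limUnder atTop` over the TORUS INDEX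
`K` ([I] (1.21) «we take a limit of these functions as T^{(j+1)} ↗ Z^d», READING (c3)); so two term families that agree on every torus `K ≥ K₀(k)` have the same β at step `k`
(`Node00.betaMerged_congr_at` is already stated «`∀ᶠ K in atTop`»).  Hence every row of the read-set induction — openness of the domain and `1 ∈ U`, cutoff agreement, the collar (hN),
continuity (hC), selector agreement (hU), nesting (hB) — is needed only at pairs `(K, k)` with `G K k` for ANY guard `G` that is ANTITONE in the level (the induction over (0.19) on ONE
torus descends from `k + 1` to `0`) and EVENTUALLY TRUE in `K` at each level.  `G K k := k + c ≤ F.m + K` is such a guard for every `c`.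
* §1 ★ `effActionHT_Tcan_eqOn_of_readSet_guarded` ∕ `mergedTermT_Tcan_eqOn_of_readSet_guarded` ∕ ★★ `betaMerged_Tcan_eq_of_readSet_guarded` ∕ ★★★
  `betaOfRecord₁₃_thm1CCMWZB_radiusBlind_of_readSet_guarded` — g19's §3∕§5 VERBATIM with the guard threaded (proofs unchanged but for the guard bookkeeping; at §1's last step
  `(eventually_gt_atTop (k+1)).and (hev (k+1))` replaces `eventually_gt_atTop (k+1)`); `levelGuard_antitone` ∕ `levelGuard_eventually` for `k + c ≤ F.m + K`.
* §2 ★ `hb0_at_of_hsol_of_numerics` — dag-n09-w4's rider `hb0_of_hsolν_of_numerics` at ONE level `j < K` from solvability at THAT level's averaged field only (its proof reads `hsolν` nowhere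
  else; proof verbatim otherwise); ★★ `firstForm_of_chiFix29_of_lipschitz_at` — file 3 §2's collar row at ONE member `(K, k)` from the slots AT THAT MEMBER (`hT1 K k`, `hUk K k` at `ā`,
  `h11 K k` at `ā`, `hLip K k`) — the solvability the rider wants at level `k + 1` is the first-form hypothesis on `V̄` itself, so no slot at another level is read.
CONSUMER: this seat's `…K0CompCofinalRadiiOfFixedRadiusGuarded` (the one-radius doors with the slots asked inside the guard only, and `hT1` there supplied by the texts).

HONEST FRAMING (binding).  Kernel bookkeeping (an `atTop`-eventually congruence of `limUnder`, an induction with a guard threaded, two single-level re-cuts of landed lemmas); NO β estimate;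
nothing of Bałaban's asserted or discharged; every row stays a displayed hypothesis of the consumer; stub 2′ OPEN; K0⁷ stmt-QuantumFields-20541 NOT closed; N07 NOT discharged; COUNT 8∕28 ·
K 1∕4 UNMOVED; R4 = the CONDITIONAL finite-𝕋⁴ rung `BalabanLadder.UV` at fixed `ε = L^(−K)` only — NOT continuum ∕ ℝ⁴ ∕ OS; the Yang–Mills mass gap (Clay) is NOT proved by any of this.
Standard axioms only.
-/

noncomputable section

open MeasureTheory Set Filter
open scoped Matrix.Norms.L2Operator

namespace Summit.QuantumFields.YangMills.BalabanUVNodes.K0Beta13RadiusBlindGuarded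

open _root_.Topology
open Literature.MathematicalPhysics.QuantumFieldTheory.Balaban1983to89
open Literature.MathematicalPhysics.QuantumFieldTheory.Balaban1983to89.Node00
open Literature.MathematicalPhysics.QuantumFieldTheory.Balaban1983to89.T4Continuum (T4Family)
open Literature.MathematicalPhysics.QuantumFieldTheory.Balaban1983to89.ExpMeanLog (deltaSU expMeanLogSU)
open Literature.MathematicalPhysics.QuantumFieldTheory.Balaban1983to89.BlockAveraging (loopHol avgFun)
open Literature.MathematicalPhysics.QuantumFieldTheory.Balaban1983to89.B12B0RestrictionNonlinear267 (norm_pertVar_b0_le_pow dist1_inv_mul_eq_norm_pertVar)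
open Literature.MathematicalPhysics.QuantumFieldTheory.Balaban1983to89.B12GaugeOrbits021 (OrbitRel)
open Literature.MathematicalPhysics.QuantumFieldTheory.Balaban1983to89.B12SmallFieldDomain259 (b0)
open B12Eq019ActionBody (integrand nextAction normConst integrand_apply nextAction_apply)
open T4FlagMemory (extd)
open B12PolarizationTensor120 (expChart)
open Summit.QuantumFields.YangMills.BalabanUVNodes.K0Beta13RadiusBlind (TcanOfRecord_eqOn_of_eq_over chiFixed29_congr_of_Uk_eq)
open Summit.QuantumFields.YangMills.BalabanUVNodes.K0Beta13RadiusBlindFirstForm (bgReg_succ_subset)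
open Summit.QuantumFields.YangMills.BalabanUVNodes.N09BackgroundRadiiTransfer (bgReg_mono mem_bgReg_iff_of_orbitRel)
open Summit.QuantumFields.YangMills.BalabanUVNodes.N09NestingOfHierAxial (hcrit_of_ukExists)
open Summit.QuantumFields.YangMills.BalabanUVNodes.K0TwoPrimeOfFixedRadiusBoxThm1Slots (h53a_at h53b_at eta_succ_sq isBackground_restrict_and_uniqueUkOrbit_of_slots)
open Summit.QuantumFields.YangMills.BalabanUVNodes.K0TwoPrimeOfMembershipDomain (cast_L_pow_d_sub_one plaqSmall_two_mul_of_firstForm)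
open Summit.QuantumFields.YangMills.BalabanUVNodes.K0TwoPrimeOfLipschitzCollar (rider_eps_eq rider_inner_eq)

/-! ## §0  The level guards `k + c ≤ m + K`: antitone in the level, eventually true in the torus index -/

section Guard

variable (F : T4Family)

/-- The S1c-type level guard `k + c ≤ F.m + K` is ANTITONE in the level. [cite: Balaban1988Convergent, (2.1) p.254 (bookkeeping)] -/
theorem levelGuard_antitone (c K k : ℕ) (h : k + 1 + c ≤ F.m + K) : k + c ≤ F.m + K := by omega

/-- … and holds EVENTUALLY in the torus index `K` at each level. [cite: Balaban1987RG1, (1.21) p.264 (bookkeeping: the `T^{(j+1)} ↗ Z^d` limit reads only large tori)] -/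
theorem levelGuard_eventually (c k : ℕ) : ∀ᶠ K in atTop, k + c ≤ F.m + K :=
  (eventually_ge_atTop (k + c)).mono fun K hK => hK.trans (Nat.le_add_left K F.m)

end Guard

/-! ## §1  The read-set induction with a level guard threaded (g19 §3 ∕ §5, proofs verbatim) -/

section ReadSet

variable {F : T4Family} {N : ℕ} [NeZero N]

/-- **THE EFFECTIVE ACTIONS AGREE ON THE DOMAIN SYSTEM, GUARDED** (`A_k^{χ} = A_k^{χ′}` on `U K k` for `k ≤ K` with `G K k`): g19's induction over (0.19) with the rows (openness,
`1 ∈ U`, cutoff agreement (hχ), collar (hN), continuity (hC)) asked only under the guard; `G` antitone in the level carries the guard down the induction.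
[cite: Balaban1987RG1, (0.17)–(0.19) p.255, p.259 (bookkeeping)] -/
theorem effActionHT_Tcan_eqOn_of_readSet_guarded (χ χ' : (K : ℕ) → (ℕ → ℝ) → (k : ℕ) → Density (F.P K) k (Node00.SU N))
    (G : ℕ → ℕ → Prop) (hmono : ∀ K k, G K (k + 1) → G K k)
    (U : (K k : ℕ) → Set (GaugeField (F.P K) k (Node00.SU N))) (hUo : ∀ K k, G K k → IsOpen (U K k))
    (hU1 : ∀ K k, G K k → (1 : GaugeField (F.P K) k (Node00.SU N)) ∈ U K k)
    (K : ℕ) (g : ℕ → ℝ)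
    (hχ : ∀ k V, k < K → G K (k + 1) → (avOfRecord F N K k).avg V ∈ U K (k + 1) → χ K g k V = χ' K g k V)
    (hN : ∀ k V, k < K → G K (k + 1) → (avOfRecord F N K k).avg V ∈ U K (k + 1) → χ K g k V ≠ 0 → V ∈ U K k)
    (hC : ∀ k, k < K → G K (k + 1) → U K (k + 1) ⊆ regSetOfRecord F N K k
      (integrand (χ K g k) (gfOfRecord F N K k) (g k) (effActionHT F N (TcanOfRecord F N) χ K g k))) :
    ∀ k, k ≤ K → G K k → EqOn (effActionHT F N (TcanOfRecord F N) χ K g k) (effActionHT F N (TcanOfRecord F N) χ' K g k) (U K k)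
  | 0, _, _ => fun V _ => by rw [effActionHT_zero, effActionHT_zero]
  | k + 1, hk, hG => by
    have hk' : k < K := Nat.lt_of_succ_le hk
    have ih := effActionHT_Tcan_eqOn_of_readSet_guarded χ χ' G hmono U hUo hU1 K g hχ hN hC k hk'.le (hmono K k hG)
    -- the two level-k integrands agree over U K (k+1)
    have hρ : ∀ V, (avOfRecord F N K k).avg V ∈ U K (k + 1) →
        integrand (χ K g k) (gfOfRecord F N K k) (g k) (effActionHT F N (TcanOfRecord F N) χ K g k) V =
          integrand (χ' K g k) (gfOfRecord F N K k) (g k) (effActionHT F N (TcanOfRecord F N) χ' K g k) V := by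
      intro V hV
      rw [integrand_apply, integrand_apply, ← hχ k V hk' hG hV]
      by_cases hz : χ K g k V = 0
      · rw [hz, zero_mul, zero_mul]
      · rw [ih (hN k V hk' hG hV hz)]
    have hT : EqOn
        (TcanOfRecord F N K k (integrand (χ K g k) (gfOfRecord F N K k) (g k) (effActionHT F N (TcanOfRecord F N) χ K g k)))
        (TcanOfRecord F N K k (integrand (χ' K g k) (gfOfRecord F N K k) (g k) (effActionHT F N (TcanOfRecord F N) χ' K g k)))
        (U K (k + 1)) := fun W hW =>
      TcanOfRecord_eqOn_of_eq_over hk' (hUo K (k + 1) hG) hρ ⟨hW, hC k hk' hG hW⟩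
    intro W hW
    rw [effActionHT_succ, effActionHT_succ, nextAction_apply, nextAction_apply, B12Eq019ActionBody.normConst_def, B12Eq019ActionBody.normConst_def,
      hT hW, hT (hU1 K (k + 1) hG)]

/-- **THE MERGED TERMS (1.6) AGREE ON `U K (k+1)`, GUARDED** (`k + 1 ≤ K`, `G K (k+1)`): first summands by the previous theorem, backgrounds by selector agreement (hbg), second
summands at the averaged background (nesting row (hB)), one level down through `G` antitone. [cite: Balaban1987RG1, (1.6) p.261, (0.23) p.256 (bookkeeping)] -/
theorem mergedTermT_Tcan_eqOn_of_readSet_guarded (χ χ' : (K : ℕ) → (ℕ → ℝ) → (k : ℕ) → Density (F.P K) k (Node00.SU N)) (ε ε' : ℝ)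
    (G : ℕ → ℕ → Prop) (hmono : ∀ K k, G K (k + 1) → G K k)
    (U : (K k : ℕ) → Set (GaugeField (F.P K) k (Node00.SU N))) (hUo : ∀ K k, G K k → IsOpen (U K k))
    (hU1 : ∀ K k, G K k → (1 : GaugeField (F.P K) k (Node00.SU N)) ∈ U K k)
    (K : ℕ) (g : ℕ → ℝ)
    (hχ : ∀ k V, k < K → G K (k + 1) → (avOfRecord F N K k).avg V ∈ U K (k + 1) → χ K g k V = χ' K g k V)
    (hN : ∀ k V, k < K → G K (k + 1) → (avOfRecord F N K k).avg V ∈ U K (k + 1) → χ K g k V ≠ 0 → V ∈ U K k)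
    (hC : ∀ k, k < K → G K (k + 1) → U K (k + 1) ⊆ regSetOfRecord F N K k
      (integrand (χ K g k) (gfOfRecord F N K k) (g k) (effActionHT F N (TcanOfRecord F N) χ K g k)))
    (hbg : ∀ k W, k < K → G K (k + 1) → W ∈ U K (k + 1) → Uk F N K (k + 1) ε W = Uk F N K (k + 1) ε' W)
    (hB : ∀ k W, k < K → G K (k + 1) → W ∈ U K (k + 1) → Averaging.iter (avOfRecord F N K) k (Uk F N K (k + 1) ε W) ∈ U K k)
    {k : ℕ} (hk : k + 1 ≤ K) (hG : G K (k + 1)) :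
    EqOn (mergedTermT F N (TcanOfRecord F N) χ ε K g k) (mergedTermT F N (TcanOfRecord F N) χ' ε' K g k) (U K (k + 1)) := by
  intro W hW
  have hk' : k < K := Nat.lt_of_succ_le hk
  have hA := effActionHT_Tcan_eqOn_of_readSet_guarded χ χ' G hmono U hUo hU1 K g hχ hN hC
  unfold mergedTermT
  rw [hA (k + 1) hk hG hW, ← hbg k W hk' hG hW, hA k hk'.le (hmono K k hG) (hB k W hk' hG hW)]

/-- ★★ **THE MERGED β AGREE, GUARDED** (every level, every history): `β_merged` at level `k` reads the merged terms on the tori `K → ∞` ONLY (`Node00.betaMerged_congr_at`: `∀ᶠ K in atTop`),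
so the rows are needed at the pairs `(K, k+1)` with `G K (k+1)` for a guard that holds EVENTUALLY in `K` at each level; there the chart field tends to the unit configuration, an interior point of
`U K (k+1)`, where the merged terms agree by the previous theorem. [cite: Balaban1987RG1, (1.20)–(1.22) p.264, (1.21) «T^{(j+1)} ↗ Z^d», (1.6) p.261 (bookkeeping)] -/
theorem betaMerged_Tcan_eq_of_readSet_guarded {V : Type*} [NormedAddCommGroup V] [NormedSpace ℝ V] {ι : Type*} [Fintype ι]
    (ρm : V →L[ℝ] Matrix (Fin N) (Fin N) ℂ) (bV : Module.Basis ι ℝ V)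
    (χ χ' : (K : ℕ) → (ℕ → ℝ) → (k : ℕ) → Density (F.P K) k (Node00.SU N)) (ε ε' : ℝ)
    (G : ℕ → ℕ → Prop) (hmono : ∀ K k, G K (k + 1) → G K k) (hev : ∀ k, ∀ᶠ K in atTop, G K k)
    (U : (K k : ℕ) → Set (GaugeField (F.P K) k (Node00.SU N))) (hUo : ∀ K k, G K k → IsOpen (U K k))
    (hU1 : ∀ K k, G K k → (1 : GaugeField (F.P K) k (Node00.SU N)) ∈ U K k)
    (hχ : ∀ K (g : ℕ → ℝ) k V, k < K → G K (k + 1) → (avOfRecord F N K k).avg V ∈ U K (k + 1) → χ K g k V = χ' K g k V)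
    (hN : ∀ K (g : ℕ → ℝ) k V, k < K → G K (k + 1) → (avOfRecord F N K k).avg V ∈ U K (k + 1) → χ K g k V ≠ 0 → V ∈ U K k)
    (hC : ∀ K (g : ℕ → ℝ) k, k < K → G K (k + 1) → U K (k + 1) ⊆ regSetOfRecord F N K k
      (integrand (χ K g k) (gfOfRecord F N K k) (g k) (effActionHT F N (TcanOfRecord F N) χ K g k)))
    (hbg : ∀ K k W, k < K → G K (k + 1) → W ∈ U K (k + 1) → Uk F N K (k + 1) ε W = Uk F N K (k + 1) ε' W)
    (hB : ∀ K k W, k < K → G K (k + 1) → W ∈ U K (k + 1) → Averaging.iter (avOfRecord F N K) k (Uk F N K (k + 1) ε W) ∈ U K k) :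
    betaMerged F (mergedTermFamilyMatT F N (TcanOfRecord F N) χ ε) ρm bV = betaMerged F (mergedTermFamilyMatT F N (TcanOfRecord F N) χ' ε') ρm bV := by
  funext k
  refine betaMerged_congr_at F ρm bV fun hist => ((eventually_gt_atTop (k + 1)).and (hev (k + 1))).mono fun K hK => ?_
  obtain ⟨hK, hG⟩ := hK
  have hmem : ∀ᶠ B in 𝓝 (0 : Fin (F.P K).d → Site (F.P K) (k + 1) → V), chartField F N ρm K (k + 1) B ∈ U K (k + 1) :=
    tendsto_chartField_zero F N ρm K (k + 1) ((hUo K (k + 1) hG).mem_nhds (hU1 K (k + 1) hG))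
  exact hmem.mono fun B hBm => by
    rw [expChart_mergedTermFamilyMatT, expChart_mergedTermFamilyMatT]
    exact mergedTermT_Tcan_eqOn_of_readSet_guarded χ χ' ε ε' G hmono U hUo hU1 K (extd hist) (hχ K _) (hN K _) (hC K _) (hbg K) (hB K) hK.le hG hBm

end ReadSet

section ZB

variable (F : T4Family) (N : ℕ) [NeZero N]

/-- ★★★ **(T2″) GUARDED — RADIUS BLINDNESS OF THE β OF RECORD AT TWO PRINT-REGIME Z3 MEMBERS, ROWS ASKED INSIDE A LEVEL GUARD ONLY.**  g19's `betaOfRecord₁₃_thm1CCMWZB_radiusBlind_of_readSet`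
VERBATIM except that the domain system's openness and `1 ∈ U`, the selector agreement (hU), the continuity row (hC), the collar (hN) and the nesting (hB) are asked only at pairs with `G K k`
(resp. `G K (k+1)`) for a guard `G` ANTITONE in the level and EVENTUALLY TRUE in `K` at each level.  Conclusion unchanged: the two members have THE SAME β (every level, every history).
CONDITIONAL on the displayed rows; NO β estimate; nothing of Bałaban's asserted.
[cite: Balaban1987RG1, (1.20)–(1.22) p.264, (1.21) «T^{(j+1)} ↗ Z^d», (1.6) p.261, (0.19) p.255, (0.21) p.256, p.259, (2.9) p.266; Balaban1985Variational, Thm 1 (8)–(10) p.279; Balaban1988Convergent, p.265 (bookkeeping)] -/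
theorem betaOfRecord₁₃_thm1CCMWZB_radiusBlind_of_readSet_guarded (j : ℕ) (γ ε₀ ε₂₉ B₃ B₃' a₁ a a' : ℝ) (Efl logz : B12.RunParams → ℕ → ℝ)
    (G : ℕ → ℕ → Prop) (hmono : ∀ K k, G K (k + 1) → G K k) (hev : ∀ k, ∀ᶠ K in atTop, G K k)
    (U : (K k : ℕ) → Set (GaugeField (F.P K) k (Node00.SU N))) (hUo : ∀ K k, G K k → IsOpen (U K k))
    (hU1 : ∀ K k, G K k → (1 : GaugeField (F.P K) k (Node00.SU N)) ∈ U K k)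
    (hU : ∀ K k W, k < K → G K (k + 1) → W ∈ U K (k + 1) → Uk F N K (k + 1) a W = Uk F N K (k + 1) a' W)
    (hC : ∀ K (g : ℕ → ℝ) k, k < K → G K (k + 1) → U K (k + 1) ⊆ regSetOfRecord F N K k
      (integrand (chiFixed29 F N (numerics7OfThm1CCM F.L j ε₀ B₃ B₃' a a₁) ε₂₉ K g k) (gfOfRecord F N K k) (g k)
        (effActionHT F N (TcanOfRecord F N) (chiFixed29 F N (numerics7OfThm1CCM F.L j ε₀ B₃ B₃' a a₁) ε₂₉) K g k)))
    (hN : ∀ K k V, k < K → G K (k + 1) → (avOfRecord F N K k).avg V ∈ U K (k + 1) →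
      chiFix29OfRecord F N (numerics7OfThm1CCM F.L j ε₀ B₃ B₃' a a₁) ε₂₉ K k V ≠ 0 → V ∈ U K k)
    (hB : ∀ K k W, k < K → G K (k + 1) → W ∈ U K (k + 1) → Averaging.iter (avOfRecord F N K) k (Uk F N K (k + 1) a W) ∈ U K k) :
    betaOfRecord₁₃ F N (theta13OfThm1CCMWZB F N j γ a ε₀ ε₂₉ B₃ B₃' a a₁ Efl logz) =
      betaOfRecord₁₃ F N (theta13OfThm1CCMWZB F N j γ a' ε₀ ε₂₉ B₃ B₃' a' a₁ Efl logz) := by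
  set θ := theta13OfThm1CCMWZB F N j γ a ε₀ ε₂₉ B₃ B₃' a a₁ Efl logz with hθ
  letI := θ.instVβ₁; letI := θ.instVβ₂; letI := θ.instιβ
  have hm : betaMerged F (mergedTermFamilyMatT F N (TcanOfRecord F N) (chiFixed29 F N (numerics7OfThm1CCM F.L j ε₀ B₃ B₃' a a₁) ε₂₉) a) θ.ρ8 θ.bV =
      betaMerged F (mergedTermFamilyMatT F N (TcanOfRecord F N) (chiFixed29 F N (numerics7OfThm1CCM F.L j ε₀ B₃ B₃' a' a₁) ε₂₉) a') θ.ρ8 θ.bV :=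
    betaMerged_Tcan_eq_of_readSet_guarded θ.ρ8 θ.bV _ _ a a' G hmono hev U hUo hU1
      (fun K g k V hk hG hV => chiFixed29_congr_of_Uk_eq ε₂₉ g (hU K k _ hk hG hV))
      (fun K g k V hk hG hV hz => hN K k V hk hG hV (by rwa [chiFixed29_apply] at hz)) hC hU hB
  funext k
  exact betaOfMerged_congr_at θ.γ (congrFun hm k) (beta0OfMerged_congr_at θ.v₀ (congrFun hm k))

end ZB

/-! ## §2  The p. 266–267 rider and file 3's collar row at ONE member -/

section SingleLevel

variable {F : T4Family} {N : ℕ} [NeZero N]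

/-- ★ **THE RIDER AT ONE LEVEL** — dag-n09-w4's `N09B0RiderAtRecord.hb0_of_hsolν_of_numerics` (✓; [I] p. 266–267, «off the guard κ_U = 1 forces T ≈ 1 while a large member forces T far
from 1») for ONE step `j < K` and ONE field `U`, from solvability AT its average `Ū` alone (`UkExists F N K (j+1) εreg Ū`; no domain membership is read) — the landed proof reads its
level-uniform `hsolν` only there; every other line verbatim. [cite: Balaban1987RG1, (2.3) p.265, (2.9) p.266 and p.267; Balaban1985Averaging, (26) p.22, Prop. 2 (53) p.26] -/
theorem hb0_at_of_hsol_of_numerics (θ₀ : Stage13Params F N) (K : ℕ) (g : ℕ → ℝ) (hεreg : 0 < θ₀.ν.εreg)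
    (hε3 : (143 * (((((F.P K).d + 4 : ℕ) : ℝ)) ^ 2 / 4) ^ 2) * θ₀.ν.εreg ≤ 1 / 3)
    (hε2 : 2 * θ₀.ν.εreg ≤ 2 * deltaSU (Fin N) / ((((F.P K).d + 4) * (F.P K).L : ℕ) : ℝ) ^ 2) (hε29 : 0 ≤ θ₀.ε₂₉)
    (hn1 : 1640 * (2 * (((((F.P K).d + 2) * (F.P K).L : ℕ) : ℝ) * θ₀.ε₂₉) +
        ((((F.P K).d + 2) * (F.P K).L : ℕ) : ℝ) ^ 2 / 4 * (2 * θ₀.ν.εreg / ((F.P K).L : ℝ) ^ 2)) * (((F.P K).L : ℝ) ^ ((F.P K).d - 1)) ^ 2 ≤ 1)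
    (hn2 : 13 * (2 * (((((F.P K).d + 2) * (F.P K).L : ℕ) : ℝ) * θ₀.ε₂₉) +
        ((((F.P K).d + 2) * (F.P K).L : ℕ) : ℝ) ^ 2 / 4 * (2 * θ₀.ν.εreg / ((F.P K).L : ℝ) ^ 2)) * ((F.P K).L : ℝ) ^ ((F.P K).d - 1) < deltaSU (Fin N))
    {j : ℕ} (hj : j < K) (U : GaugeField (F.P K) j (SU N))
    (hsol : UkExists F N K (j + 1) θ₀.ν.εreg ((avOfRecord F N K j).avg U)) (hχ : chiβOfRecord₁₃ F N θ₀ K g j U = 1) :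
    ∀ b : PBond (F.P K) j, IsB0 b →
      fluctDevOfRecord F N θ₀.ν K j U b ≤ 10 * (((((F.P K).d + 2) * (F.P K).L : ℕ) : ℝ) * θ₀.ε₂₉) * ((F.P K).L : ℝ) ^ ((F.P K).d - 1) := by
  intro b hb
  obtain ⟨c, rfl⟩ := hb
  have hjr : j + 1 ≤ (F.P K).m + (F.P K).K := by rw [T4Family.P_m, T4Family.P_K]; have := F.hm; omega
  have hd : 2 ≤ (F.P K).d := by rw [T4Family.P_d]; norm_num
  set W := (avOfRecord F N K j).avg U with hW
  set V := critCfgOfRecord F N θ₀.ν K j W with hV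
  -- the same average at `c`
  have hM : avgFun (expMeanLogSU (n := Fin N)) U c = avgFun (expMeanLogSU (n := Fin N)) V c := by
    have h1 : (avOfRecord F N K j).avg V = W := avg_critCfgOfRecord hsol
    have h2 : (avOfRecord F N K j).avg U = W := rfl
    rw [avOfRecord_avg] at h1 h2
    exact (congrFun h2 c).trans (congrFun h1 c).symm
  -- the fluctuation is `ε₂₉`-small off the distinguished bonds
  have hχ' : chiFix29OfRecord F N θ₀.ν θ₀.ε₂₉ K j U = 1 := hχ
  have hF : ∀ b : PBond (F.P K) j, (∀ c' : PBond (F.P K) (j + 1), b ≠ b0 c') →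
      ‖BlockAveragingEMLLinearisedBackground.pertVar V U b‖ ≤ θ₀.ε₂₉ := by
    intro b hb
    have h := (chiFix29OfRecord_eq_one_iff θ₀.ν θ₀.ε₂₉ K j U).1 hχ' b (fun ⟨c', hc'⟩ => hb c' hc'.symm)
    rw [fluctDevOfRecord_apply, ← hW, ← hV, dist1_inv_mul_eq_norm_pertVar] at h
    exact h.le
  -- the background loops are small ([B7] Prop 2 at the record)
  have hL0 : (0 : ℝ) < (F.P K).L := by exact_mod_cast (F.P K).L_pos
  have hcrit : PlaqSmall (2 * θ₀.ν.εreg / ((F.P K).L : ℝ) ^ 2) V :=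
    hcrit_of_ukExists θ₀.ν hεreg hε3 hε2 (by rw [div_mul_cancel₀ _ (by positivity)]) hsol
  have ha : 0 ≤ 2 * θ₀.ν.εreg / ((F.P K).L : ℝ) ^ 2 := by positivity
  have hloops : ∀ i, dist1 (loopHol V c i) ≤ ((((F.P K).d + 2) * (F.P K).L : ℕ) : ℝ) ^ 2 / 4 * (2 * θ₀.ν.εreg / ((F.P K).L : ℝ) ^ 2) :=
    fun i => BlockAveragingEMLProp2.dist1_loopHol_le' ha (fun q => (hcrit q).le) c i
  -- the nonlinear rider
  have h := norm_pertVar_b0_le_pow hjr hd U V c hε29 hM hF hloops hn1 hn2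
  rw [fluctDevOfRecord_apply, ← hW, ← hV, dist1_inv_mul_eq_norm_pertVar]
  exact h

/-- ★★ **THE COLLAR ROW (hS) AT ONE MEMBER `(K, k)` FROM THE SLOTS AT THAT MEMBER** — file 3 §2's `firstForm_of_chiFix29_of_lipschitz` with its level-uniform slot `h11` (read at levels `k`
and `k + 1`) replaced by `h11` AT LEVEL `k` only: the rider's solvability input at level `k + 1` is the first-form hypothesis on `V̄` itself (`UkExists F N K (k+1) a V̄`), so the single-level
rider `hb0_at_of_hsol_of_numerics` applies; every other line verbatim.  CONDITIONAL on `hLip` ([15] Prop. 9 species) and the slots at `(K, k)`; nothing of Bałaban's asserted.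
[cite: Balaban1987RG1, (2.3) p.265, (2.9) p.266 and p.267, (1.1)–(1.2) p.260; Balaban1985Variational, Prop. 9 p.309, (181)–(182) p.307, (190) p.308, Thm 1 (6),(8)–(10) p.279; Balaban1985Averaging, Prop. 2 (53) p.26] -/
theorem firstForm_of_chiFix29_of_lipschitz_at (K k : ℕ) (hk : k < K) {a ρ δ₁₁ α₀ α₁ B tL rL BL ε₂₉ : ℝ}
    (ha : 0 < a) (haα : a ≤ α₀) (hB : 0 ≤ B) (ha53a : 143 * 256 * a ≤ 1 / 3) (ha53b : 2 * a ≤ 2 * deltaSU (Fin N) / (8 * (F.L : ℝ)) ^ 2)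
    (hρ : 0 < ρ) (h53a : 143 * 256 * ρ ≤ 1 / 3) (h53b : 2 * ρ ≤ 2 * deltaSU (Fin N) / (8 * (F.L : ℝ)) ^ 2)
    (hδ : 2 * ρ ≤ δ₁₁) (hα₁ : 2 * ρ ≤ α₁) (hBρ : 2 * B * ρ ≤ a) (hε29 : 0 ≤ ε₂₉)
    (hn1 : 1640 * (12 * (F.L : ℝ) * ε₂₉ + 18 * a) * (F.L : ℝ) ^ 6 ≤ 1) (hn2 : 13 * (12 * (F.L : ℝ) * ε₂₉ + 18 * a) * (F.L : ℝ) ^ 3 < deltaSU (Fin N))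
    (htL : 60 * (F.L : ℝ) ^ 4 * ε₂₉ ≤ tL) (hrL : ρ / (F.L : ℝ) ^ 2 ≤ rL) (hLρ : ρ / (F.L : ℝ) ^ 2 + BL * (60 * (F.L : ℝ) ^ 4 * ε₂₉) ≤ ρ)
    (hT1 : ∀ ε₁ : ℝ, 0 < ε₁ → ε₁ ≤ α₁ → ∀ V : GaugeField (F.P K) k (SU N), PlaqSmall ε₁ V →
      (∃ U : GaugeField (F.P K) 0 (SU N), IsBackground (avOfRecord F N K) {U | InUkClassB11 F N K k (B * ε₁) U} k V U) ∧
      (∀ ε₀ : ℝ, B * ε₁ ≤ ε₀ → ε₀ ≤ α₀ → ∀ U U' : GaugeField (F.P K) 0 (SU N),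
          IsBackground (avOfRecord F N K) {U | InUkClassB11 F N K k (B * ε₁) U} k V U →
          IsBackground (avOfRecord F N K) {U | InUkClassB11 F N K k ε₀ U} k V U' → InUkClassB11 F N K k ε₀ U ∧ OrbitRel k U U'))
    (hUk : ∀ (V : GaugeField (F.P K) k (SU N)) (δ : ℝ), 0 < δ → δ ≤ α₁ → B * δ ≤ a → PlaqSmall δ V →
      UkExists F N K k a V ∧ InUkClassB11 F N K k a (Uk F N K k a V))
    (h11 : ∀ V : GaugeField (F.P K) k (SU N), PlaqSmall δ₁₁ V → UkExists F N K k a V ∧ UniqueUkOrbit F N K k a V)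
    (hLip : ∀ (V V' : GaugeField (F.P K) k (SU N)) (t r : ℝ), 0 ≤ t → t ≤ tL → 0 < r → r ≤ rL →
      (∀ b, dist1 ((V' b)⁻¹ * V b) ≤ t) →
      (UkExists F N K k a V' ∧ ∀ U₁, IsBackground (avOfRecord F N K) (bgReg F N K k a) k V' U₁ → U₁ ∈ bgReg F N K k r) →
      (UkExists F N K k a V ∧ ∀ U₁, IsBackground (avOfRecord F N K) (bgReg F N K k a) k V U₁ → U₁ ∈ bgReg F N K k (r + BL * t)))
    {V : GaugeField (F.P K) k (SU N)}
    (hW : UkExists F N K (k + 1) a ((avOfRecord F N K k).avg V) ∧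
      ∀ U₁, IsBackground (avOfRecord F N K) (bgReg F N K (k + 1) a) (k + 1) ((avOfRecord F N K k).avg V) U₁ → U₁ ∈ bgReg F N K (k + 1) ρ)
    (hz : chiFix29OfRecord F N (numerics7OfThm1CCM F.L 0 δ₁₁ 0 0 a 0) ε₂₉ K k V ≠ 0) :
    UkExists F N K k a V ∧ ∀ U₁, IsBackground (avOfRecord F N K) (bgReg F N K k a) k V U₁ → U₁ ∈ bgReg F N K k ρ := by
  -- the `δ₁₁`-member and its numerics carrier (`εreg = a`, `ε₀ = δ₁₁`, `ε₂₉` — all `rfl`)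
  set θ := theta13OfThm1CCMWZB F N 0 (1 / 2) a δ₁₁ ε₂₉ 0 0 a 0 (fun _ _ => 0) (fun _ _ => 0) with hθ
  have hreg : θ.ν.εreg = a := rfl
  have h29 : θ.ε₂₉ = ε₂₉ := rfl
  have hL1 : (1 : ℝ) ≤ (F.L : ℝ) := by exact_mod_cast F.hL.2.le
  have hL0 : (0 : ℝ) < (F.L : ℝ) := by linarith
  obtain ⟨hexW, hregW⟩ := hW
  -- the reference field `V^{(k)} = Ū^k(U_{k+1}(a; V̄))` is first-form of membership `ρ∕L²`
  have hL2 : (1 : ℝ) ≤ (F.L : ℝ) ^ 2 := one_le_pow₀ hL1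
  have hδL : 2 * ρ ≤ δ₁₁ * (F.L : ℝ) ^ 2 := hδ.trans (le_mul_of_one_le_right (by linarith) hL2)
  have hα₁L : 2 * ρ ≤ α₁ * (F.L : ℝ) ^ 2 := hα₁.trans (le_mul_of_one_le_right (by linarith) hL2)
  obtain ⟨hR, hQ⟩ := isBackground_restrict_and_uniqueUkOrbit_of_slots K k ha haα hρ h53a h53b hδL hα₁L hB hBρ hT1 hUk h11 hexW hregW
  have hmem' : Uk F N K (k + 1) a ((avOfRecord F N K k).avg V) ∈ bgReg F N K k (ρ / (F.L : ℝ) ^ 2) := by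
    have h := hregW _ (isBackground_Uk hexW)
    rw [mem_bgReg_iff] at h ⊢
    intro p
    have hp := h p
    rw [eta_succ_sq] at hp
    calc dist1 (GaugeField.plaqHol (Uk F N K (k + 1) a ((avOfRecord F N K k).avg V)) p) < ρ * ((F.P K).eta k ^ 2 / (F.L : ℝ) ^ 2) := hp
      _ = ρ / (F.L : ℝ) ^ 2 * (F.P K).eta k ^ 2 := by ring
  have hff' : UkExists F N K k a (critCfgOfRecord F N θ.ν K k ((avOfRecord F N K k).avg V)) ∧
      ∀ U₁, IsBackground (avOfRecord F N K) (bgReg F N K k a) k (critCfgOfRecord F N θ.ν K k ((avOfRecord F N K k).avg V)) U₁ →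
        U₁ ∈ bgReg F N K k (ρ / (F.L : ℝ) ^ 2) := by
    rw [critCfgOfRecord_def, hreg]
    exact ⟨⟨_, hR⟩, fun U₁ h₁ => (mem_bgReg_iff_of_orbitRel (hQ _ _ h₁ hR)).2 hmem'⟩
  -- `χ = 1` at the `δ₁₁`-member (same `εreg` as the statement's carrier)
  have hχ1 : chiβOfRecord₁₃ F N θ K (fun _ => 0) k V = 1 := by
    have h01 := chiFix29OfRecord_eq_zero_or_one (F := F) (N := N) (numerics7OfThm1CCM F.L 0 δ₁₁ 0 0 a 0) ε₂₉ K k V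
    exact h01.resolve_left hz
  -- solvability at level `k + 1` AT THE AVERAGED FIELD is the first-form hypothesis itself (`θ.ν.εreg = a`)
  have hsol : UkExists F N K (k + 1) θ.ν.εreg ((avOfRecord F N K k).avg V) := by rw [hreg]; exact hexW
  -- bondwise closeness of `V` to `V^{(k)}`: non-distinguished bonds by (2.9), distinguished ones by the single-level rider
  have ht0 : 0 ≤ 60 * (F.L : ℝ) ^ 4 * ε₂₉ := by positivity
  have hε₂₉t : ε₂₉ ≤ 60 * (F.L : ℝ) ^ 4 * ε₂₉ := by
    have h1 : (1 : ℝ) ≤ 60 * (F.L : ℝ) ^ 4 := by nlinarith [one_le_pow₀ (n := 4) hL1]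
    nlinarith
  have hclose : ∀ b : PBond (F.P K) k, dist1 ((critCfgOfRecord F N θ.ν K k ((avOfRecord F N K k).avg V) b)⁻¹ * V b) ≤ 60 * (F.L : ℝ) ^ 4 * ε₂₉ := by
    intro b
    rw [← fluctDevOfRecord_apply]
    by_cases hb : IsB0 b
    · have h := hb0_at_of_hsol_of_numerics θ K (fun _ => 0) (by rw [hreg]; exact ha) (by rw [hreg]; exact h53a_at K ha53a) (by rw [hreg]; exact h53b_at K ha53b)
        (by rw [h29]; exact hε29) (by rw [hreg, h29, rider_inner_eq, cast_L_pow_d_sub_one, ← pow_mul]; exact hn1)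
        (by rw [hreg, h29, rider_inner_eq, cast_L_pow_d_sub_one]; exact hn2) hk V hsol hχ1 b hb
      rw [h29, rider_eps_eq] at h
      exact h
    · exact (((chiFix29OfRecord_eq_one_iff θ.ν ε₂₉ K k V).1 hχ1) b hb).le.trans hε₂₉t
  -- the Lipschitz row
  have hρL2 : 0 < ρ / (F.L : ℝ) ^ 2 := by positivity
  obtain ⟨hexV, hregV⟩ := hLip V _ (60 * (F.L : ℝ) ^ 4 * ε₂₉) (ρ / (F.L : ℝ) ^ 2) ht0 htL hρL2 hrL hclose hff'
  exact ⟨hexV, fun U₁ h₁ => bgReg_mono hLρ (hregV U₁ h₁)⟩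

end SingleLevel

end Summit.QuantumFields.YangMills.BalabanUVNodes.K0Beta13RadiusBlindGuarded
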